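import Mathlib
import Summits.KontsevichZagierPeriods.Zeta5Search.BrickHoleMultiplier

/-!
# BrickHoleWeight — zi-p2's THEOREM 10 LEMMA 10.2 (c) / 10.3 for either kernel: Wilson-block DIGIT-LOCALITY of the
hole multiplier `μ_k = c_{k,A}(n)/c̃_{K',A}(m)`, and the HOLE BLOCK WEIGHT `G(K') = Σ_{k₀ > n₀} g(k₀+K'p)·μ_{k₀+K'p}`
on the row `m = N' − 1`: `p^A ∣ G`, `v(G(m−K') + G(K')) ≤ exp(−(A+L+1))`, `v(G(K'₂) − G(K'₁)) ≤ exp(−(A+e))`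
(cell zeta5-irr)

HONEST FRAMING: systematic search; no irrationality claim unless certified. INSTRUMENT lemmas of the ζ(5)
census cell zeta5-irr (HOME `run/shared/lean/pub/zeta5-irr/`; memo `zi-p2/probes/B8/thm10/THEOREM10.md` (sealed
eeb9a92811d678e0) LEMMA 10.2 «(c) LOCALITY. K* = K + p^{e+1}t has K*₀ = K₀ (same class) and K*′ = K′ + p^et … each of
K*!_p/K!_p, … is the product of the prime-to-p integers of t consecutive blocks of p^{e+1} consecutive integers», LEMMA
10.3 «the combined weight … w_g(N′−1−K′) + w_g(K′) ≡ 0 (mod p^Λ) … w_g(K′*) ≡ w_g(K′) (mod p^e) … Hence ω^{hole}_g =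
w_g·P_0 is an ADMISSIBLE weight for the row N″ = N′ − 1»). DESIGN: the tree's hole weight is `G(K') = Σ_{k₀∈(n₀,p)}
g(k)·μ_k` with `μ_k = c_{k,A}(n)/c̃_{K',A}(m)` (zi-p2's `p^{B|ε|+c}Λ°·(m+1)^{A−2B}Ê·Q^{cl}_0` summed over classes, times
`p^A`); reflection is `cTop_reflect` (`μ_{n−k} = (−1)^ε μ_k`), so no class-swap bookkeeping is needed, and `G/p^A` is
admissible for the row `m` at level `L` whenever `g` satisfies (I)(S_ε)(D) at level `L+1` on the row `n`. Nothing
here is about ζ(5); no irrationality content; filing moves no rung. Filed by the engine seat zi-eng (g10).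

## The statements (`p` odd prime, `A` even, `2B ≤ A`; row `n = n₀ + (m+1)p`, `n₀ < p`; hole digits `k₀ ∈ (n₀, p)`)

* `holeParts_zmod_eq`, **`mu_local`**: for hole cells `k = i + Jp`, `k' = i + J'p` with `J'p = Jp + p^{e+1}q`:
  `v(μ' − μ) ≤ exp(−(A+e))`.
* `holeWeight A B ε p n₀ m g K' := Σ_{k₀ ∈ Ico (n₀+1) p} g(k₀+K'p)·(cTop A B ε n (k₀+K'p) / cTop A B 0 m K')`;
  **`holeWeight_le`** (`v ≤ exp(−A)`), **`holeWeight_reflect_add_le`** (`v(G(m−K') + G(K')) ≤ exp(−(A+L+1))` from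
  (S_ε) at level `L+1`), **`holeWeight_local`** (`v(G(K'₂) − G(K'₁)) ≤ exp(−(A+e))` for `p^e ∣ K'₁ − K'₂`, `e ≤ L`,
  from (D) at depth `e+1`).
-/

namespace Summit.KontsevichZagierPeriods.Zeta5Search.BrickHoleWeight

open Finset Nat Polynomial WithZero
open Summit.KontsevichZagierPeriods.Zeta5Search.BrickTopCoefficient (cTop cTop_reflect)
open Summit.KontsevichZagierPeriods.Zeta5Search.BrickLambda (cTop_zero_ne_zero padicValuation_two)
open Summit.KontsevichZagierPeriods.Zeta5Search.BrickResidueLawMain (cong_mul_le)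
open Summit.KontsevichZagierPeriods.Zeta5Search.BrickLambdaLocality (padicValuation_sub_le_of_zmod_eq cong_pow_le sub_shift)
open Summit.KontsevichZagierPeriods.Zeta5Search.BrickLambdaDigit (cTop_zero_reflect cTop_reflect_le_one)
open Summit.KontsevichZagierPeriods.Zeta5Search.GaussWilsonBlock (unitFactorial unitFactorial_shift_iter)
open Summit.KontsevichZagierPeriods.Zeta5Search.BrickHatStrip (hatPoly hatPoly_eval_zero_ne_zero)
open Summit.KontsevichZagierPeriods.Zeta5Search.BrickHatWeight (padicValuation_hatPoly_eval_zero_le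
  padicValuation_hatPoly_eval_zero_sub_le)
open Summit.KontsevichZagierPeriods.Zeta5Search.BrickHoleMultiplier (holeUnitPart holeGainPart mu_mul_holeUnitPart
  padicValuation_holeUnitPart padicValuation_holeGainPart_le padicValuation_mu_le)
open Literature.NumberTheory.LFunctions (padicValuation_natCast_le_one)

noncomputable section

variable {p : ℕ} [Fact p.Prime]

/-! ## LEMMA 10.2 (c): locality of the hole multiplier -/

section locality

variable (hp2 : p ≠ 2) {A B ε n₀ i i' J M J' M' e q : ℕ} (hJM : J' + M' = J + M)
  (hq : J' * p = J * p + p ^ (e + 1) * q)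
include hp2 hJM hq

/-- The unit and gained parts of the two hole cells agree mod `p^{e+1}` (Wilson blocks of length `p^{e+1}`; the paid
class members move by a multiple of `p^{e+1}`). -/
theorem holeParts_zmod_eq :
    (holeUnitPart p A B n₀ i i' J' M' : ZMod (p ^ (e + 1))) = (holeUnitPart p A B n₀ i i' J M : ZMod (p ^ (e + 1))) ∧
      (holeGainPart p A B n₀ i i' J' M' : ZMod (p ^ (e + 1))) = (holeGainPart p A B n₀ i i' J M : ZMod (p ^ (e + 1))) := by
  have hp : p.Prime := Fact.out
  have h3 : 3 ≤ p := by have := hp.two_le; omega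
  have he : 1 ≤ e + 1 := by omega
  have hMq := sub_shift (p := p) hJM hq
  have hpe : ((p : ZMod (p ^ (e + 1))) ^ (e + 1)) = 0 := by rw [← Nat.cast_pow, ZMod.natCast_self]
  have s1 : (unitFactorial p (i + J' * p) : ZMod (p ^ (e + 1))) = (-1) ^ q * unitFactorial p (i + J * p) := by
    rw [show i + J' * p = (i + J * p) + p ^ (e + 1) * q by rw [add_assoc, ← hq],
      unitFactorial_shift_iter p (e + 1) _ q hp h3 he]
  have s2 : (unitFactorial p (i' + M * p) : ZMod (p ^ (e + 1))) = (-1) ^ q * unitFactorial p (i' + M' * p) := by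
    rw [show i' + M * p = (i' + M' * p) + p ^ (e + 1) * q by rw [add_assoc, ← hMq],
      unitFactorial_shift_iter p (e + 1) _ q hp h3 he]
  have s3 : (unitFactorial p (n₀ + (J + M + 1) * p + (i + J' * p)) : ZMod (p ^ (e + 1))) =
      (-1) ^ q * unitFactorial p (n₀ + (J + M + 1) * p + (i + J * p)) := by
    rw [show n₀ + (J + M + 1) * p + (i + J' * p) = (n₀ + (J + M + 1) * p + (i + J * p)) + p ^ (e + 1) * q by
      rw [hq]; ring, unitFactorial_shift_iter p (e + 1) _ q hp h3 he]
  have s4 : (unitFactorial p (i' + M * p + (n₀ + (J + M + 1) * p)) : ZMod (p ^ (e + 1))) =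
      (-1) ^ q * unitFactorial p (i' + M' * p + (n₀ + (J + M + 1) * p)) := by
    rw [show i' + M * p + (n₀ + (J + M + 1) * p) = (i' + M' * p + (n₀ + (J + M + 1) * p)) + p ^ (e + 1) * q by
      rw [hMq]; ring, unitFactorial_shift_iter p (e + 1) _ q hp h3 he]
  have e5 : p * (J + M + 1 + J' + 1) = p * (J + M + 1 + J + 1) + p ^ (e + 1) * q := by
    calc p * (J + M + 1 + J' + 1) = p * (J + M + 1) + J' * p + p := by ring
      _ = p * (J + M + 1) + (J * p + p ^ (e + 1) * q) + p := by rw [hq]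
      _ = _ := by ring
  have e6 : p * (J + M + 1 + M + 1) = p * (J + M + 1 + M' + 1) + p ^ (e + 1) * q := by
    calc p * (J + M + 1 + M + 1) = p * (J + M + 1) + M * p + p := by ring
      _ = p * (J + M + 1) + (M' * p + p ^ (e + 1) * q) + p := by rw [hMq]
      _ = _ := by ring
  have s5 : (p : ZMod (p ^ (e + 1))) * ((J + M + 1 + J' + 1 : ℕ) : ZMod (p ^ (e + 1))) =
      (p : ZMod (p ^ (e + 1))) * ((J + M + 1 + J + 1 : ℕ) : ZMod (p ^ (e + 1))) := by
    rw [← Nat.cast_mul, ← Nat.cast_mul, e5, Nat.cast_add, Nat.cast_mul (p ^ (e + 1)), Nat.cast_pow, hpe, zero_mul,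
      add_zero]
  have s6 : (p : ZMod (p ^ (e + 1))) * ((J + M + 1 + M + 1 : ℕ) : ZMod (p ^ (e + 1))) =
      (p : ZMod (p ^ (e + 1))) * ((J + M + 1 + M' + 1 : ℕ) : ZMod (p ^ (e + 1))) := by
    rw [← Nat.cast_mul, ← Nat.cast_mul, e6, Nat.cast_add, Nat.cast_mul (p ^ (e + 1)), Nat.cast_pow, hpe, zero_mul,
      add_zero]
  unfold holeUnitPart holeGainPart
  rw [hJM]
  simp only [Nat.cast_mul, Nat.cast_pow]
  rw [s1, s2, s3, s4, s5, s6]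
  constructor <;> ring

include hp2 in
/-- **LEMMA 10.2 (c), LOCALITY of the hole multiplier** (`A` even, `p` odd, `2B ≤ A`): for the hole cells `k = i + Jp`,
`k' = i + J'p` of the row `n = n₀ + (m+1)p` (`J + M = J' + M' = m`, digits `i + i' = n₀ + p`, `i, i' < p`) with
`J'p = Jp + p^{e+1}q` (so `p^e ∣ J' − J`) and any `μ, μ'` with `μ·c̃_{J,A}(m) = c_{k,A}(n)`, `μ'·c̃_{J',A}(m) = c_{k',A}(n)`:
`v(μ' − μ) ≤ exp(−(A+e))`. -/
theorem mu_local (hA : Even A) (hAB : 2 * B ≤ A) (hii : i + i' = n₀ + p) (hi : i < p) (hi' : i' < p) (hn₀ : n₀ < p)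
    {mu mu' : ℚ} (hmu : mu * cTop A B 0 (J + M) J = cTop A B ε (n₀ + (J + M + 1) * p) (i + J * p))
    (hmu' : mu' * cTop A B 0 (J' + M') J' = cTop A B ε (n₀ + (J' + M' + 1) * p) (i + J' * p)) :
    Rat.padicValuation p (mu' - mu) ≤ exp (-((A : ℤ) + e)) := by
  have hp : p.Prime := Fact.out
  have hpQ : (p : ℚ) ≠ 0 := by exact_mod_cast hp.ne_zero
  have hnQ : (((J + M + 1 : ℕ) : ℚ)) ≠ 0 := by positivity
  have hL := mu_mul_holeUnitPart (p := p) hA hii hi hi' hn₀ (ε := ε) (J := J) (M := M) hmu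
  have hL' := mu_mul_holeUnitPart (p := p) hA hii hi hi' hn₀ (ε := ε) (J := J') (M := M') hmu'
  rw [hJM] at hL'
  -- notation
  set s : ℚ := (-1) ^ ((n₀ + (J + M + 1) * p) * B + (J + M + 1) * B) with hs
  set c : ℚ := (((n₀ + (J + M + 1) * p : ℕ) : ℚ)) / 2 - ((i + J * p : ℕ) : ℚ) with hc
  set c' : ℚ := (((n₀ + (J + M + 1) * p : ℕ) : ℚ)) / 2 - ((i + J' * p : ℕ) : ℚ) with hc'
  set P : ℚ := (p : ℚ) ^ A * (((J + M + 1 : ℕ) : ℚ)) ^ A with hP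
  set N2 : ℚ := (((J + M + 1 : ℕ) : ℚ)) ^ (2 * B) with hN2
  set E : ℚ := (hatPoly B (J + M) J).eval 0 with hE
  set E' : ℚ := (hatPoly B (J + M) J').eval 0 with hE'
  set U : ℚ := (holeUnitPart p A B n₀ i i' J M : ℚ) with hU
  set U' : ℚ := (holeUnitPart p A B n₀ i i' J' M' : ℚ) with hU'
  set Y : ℚ := (holeGainPart p A B n₀ i i' J M : ℚ) with hY
  set Y' : ℚ := (holeGainPart p A B n₀ i i' J' M' : ℚ) with hY'
  -- valuations of the pieces
  have vU : Rat.padicValuation p U = 1 := padicValuation_holeUnitPart (p := p) A B n₀ i i' J M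
  have vU' : Rat.padicValuation p U' = 1 := padicValuation_holeUnitPart (p := p) A B n₀ i i' J' M'
  have vY : Rat.padicValuation p Y ≤ 1 := padicValuation_holeGainPart_le (p := p) A B n₀ i i' J M
  have vY' : Rat.padicValuation p Y' ≤ 1 := padicValuation_holeGainPart_le (p := p) A B n₀ i i' J' M'
  have vE : Rat.padicValuation p E ≤ 1 := padicValuation_hatPoly_eval_zero_le B _ _
  have vE' : Rat.padicValuation p E' ≤ 1 := padicValuation_hatPoly_eval_zero_le B _ _
  have hU0 : U ≠ 0 := fun h => by rw [h, map_zero] at vU; exact zero_ne_one vU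
  have hU'0 : U' ≠ 0 := fun h => by rw [h, map_zero] at vU'; exact zero_ne_one vU'
  have hN20 : N2 ≠ 0 := pow_ne_zero _ hnQ
  have vN2 : Rat.padicValuation p N2 ≠ 0 := (Valuation.ne_zero_iff _).2 hN20
  have vs : Rat.padicValuation p s = 1 := by rw [hs, map_pow, Valuation.map_neg, map_one, one_pow]
  have vn : Rat.padicValuation p (((J + M + 1 : ℕ) : ℚ)) ≤ 1 := padicValuation_natCast_le_one _
  have vP : Rat.padicValuation p P = exp (-(A : ℤ)) * (Rat.padicValuation p (((J + M + 1 : ℕ) : ℚ)) ^ (A - 2 * B) *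
      Rat.padicValuation p N2) := by
    rw [hP, hN2, map_mul, map_pow, map_pow, map_pow, Rat.padicValuation_self, ← exp_nsmul, nsmul_eq_mul, mul_neg_one,
      ← pow_add, Nat.sub_add_cancel hAB]
  have hcen : ∀ x : ℕ, Rat.padicValuation p ((((n₀ + (J + M + 1) * p : ℕ) : ℚ)) / 2 - (x : ℚ)) ≤ 1 := by
    intro x
    rw [show (((n₀ + (J + M + 1) * p : ℕ) : ℚ)) / 2 - (x : ℚ) = ((((n₀ + (J + M + 1) * p : ℕ) : ℤ) - 2 * x : ℤ) : ℚ) / 2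
      by push_cast; ring, map_div₀, padicValuation_two hp2, div_one, Rat.padicValuation_cast]
    exact Int.padicValuation_le_one _ _
  have vc : Rat.padicValuation p c ≤ 1 := by rw [hc]; exact_mod_cast hcen (i + J * p)
  have vc' : Rat.padicValuation p c' ≤ 1 := by rw [hc']; exact_mod_cast hcen (i + J' * p)
  -- the congruences
  have hee : exp (-(((e + 1 : ℕ)) : ℤ)) ≤ exp (-(e : ℤ)) := by rw [exp_le_exp]; push_cast; omega
  have vUU : Rat.padicValuation p (U - U') ≤ exp (-(e : ℤ)) := by
    rw [Valuation.map_sub_swap]; exact (padicValuation_sub_le_of_zmod_eq (holeParts_zmod_eq hp2 hJM hq).1).trans hee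
  have vYY : Rat.padicValuation p (Y' - Y) ≤ exp (-(e : ℤ)) :=
    (padicValuation_sub_le_of_zmod_eq (holeParts_zmod_eq hp2 hJM hq).2).trans hee
  have vEE : Rat.padicValuation p (E' - E) ≤ exp (-(e : ℤ)) := by
    refine padicValuation_hatPoly_eval_zero_sub_le (p := p) B (J + M) ⟨-(q : ℤ), ?_⟩
    have hq' : ((J' : ℤ) - J) * p = (p : ℤ) ^ (e + 1) * q := by
      have := congrArg (fun x : ℕ => (x : ℤ)) hq; push_cast at this; linarith
    have hp0 : (p : ℤ) ≠ 0 := by exact_mod_cast hp.ne_zero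
    have : ((J : ℤ) - J') * p = ((p : ℤ) ^ e * -(q : ℤ)) * p := by rw [pow_succ] at hq'; linarith
    exact mul_right_cancel₀ hp0 this
  have vcc : Rat.padicValuation p (c' - c) ≤ exp (-(e : ℤ)) := by
    have : c' - c = -((p : ℚ) ^ (e + 1) * q) := by
      have hq' : ((i + J' * p : ℕ) : ℚ) = ((i + J * p : ℕ) : ℚ) + (p : ℚ) ^ (e + 1) * q := by
        exact_mod_cast (by rw [hq]; ring : i + J' * p = i + J * p + p ^ (e + 1) * q)
      rw [hc, hc', hq']; ring
    rw [this, Valuation.map_neg, map_mul, map_pow, Rat.padicValuation_self, ← exp_nsmul, nsmul_eq_mul, mul_neg_one]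
    calc _ ≤ exp (-(((e + 1 : ℕ)) : ℤ)) * 1 := mul_le_mul' le_rfl (padicValuation_natCast_le_one q)
      _ ≤ _ := by rw [mul_one]; exact hee
  -- `(μ' − μ)·U·U'·N2 = s·P·(c'^ε E' Y' U − c^ε E Y U')`
  have hdiff : (mu' - mu) * (U * U' * N2) = s * P * (c' ^ ε * E' * Y' * U - c ^ ε * E * Y * U') := by
    have e1 : mu' * U' * N2 = s * c' ^ ε * P * E' * Y' := hL'
    have e2 : mu * U * N2 = s * c ^ ε * P * E * Y := hL
    linear_combination U * e1 - U' * e2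
  have hbr : Rat.padicValuation p (c' ^ ε * E' * Y' * U - c ^ ε * E * Y * U') ≤ exp (-(e : ℤ)) := by
    refine cong_mul_le (cong_mul_le (cong_mul_le (cong_pow_le vcc vc' vc ε) vEE ?_ vE) vYY ?_ vY) vUU ?_
      (by rw [vU'])
    · rw [map_pow]; exact pow_le_one' vc' ε
    · rw [map_mul, map_pow]; exact mul_le_one' (pow_le_one' vc' ε) vE'
    · rw [map_mul, map_mul, map_pow]; exact mul_le_one' (mul_le_one' (pow_le_one' vc' ε) vE') vY'
  have key : Rat.padicValuation p (mu' - mu) * Rat.padicValuation p N2 ≤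
      exp (-((A : ℤ) + e)) * Rat.padicValuation p N2 := by
    have h := congrArg (Rat.padicValuation p) hdiff
    rw [map_mul, map_mul, map_mul, vU, vU', mul_one, one_mul, map_mul, map_mul, vs, one_mul, vP] at h
    rw [h]
    calc _ ≤ exp (-(A : ℤ)) * (1 * Rat.padicValuation p N2) * exp (-(e : ℤ)) :=
          mul_le_mul' (mul_le_mul' le_rfl (mul_le_mul' (pow_le_one' vn _) le_rfl)) hbr
      _ = _ := by rw [one_mul, mul_right_comm, ← exp_add]; congr 2; ring
  have h' := mul_le_mul' (le_refl (Rat.padicValuation p N2)⁻¹) key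
  rwa [mul_comm (Rat.padicValuation p (mu' - mu)), mul_comm (exp _), ← mul_assoc, ← mul_assoc, inv_mul_cancel₀ vN2,
    one_mul, one_mul] at h'

end locality

/-! ## LEMMA 10.3: the hole block weight -/

/-- **zi-p2's combined HOLE WEIGHT** of the row `n = n₀ + (m+1)p` (kernel `ε`, weight `g`) on the row `m` of `R̃`:
`G(K') = Σ_{n₀ < k₀ < p} g(k₀ + K'p)·μ_{k₀+K'p}`, `μ_k = c_{k,A}(n)/c̃_{K',A}(m)` (all classes at once; `p^A ∣ G`). -/
def holeWeight (A B ε p n₀ m : ℕ) (g : ℕ → ℚ) (K' : ℕ) : ℚ :=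
  ∑ k₀ ∈ Ico (n₀ + 1) p, g (k₀ + K' * p) * (cTop A B ε (n₀ + (m + 1) * p) (k₀ + K' * p) / cTop A B 0 m K')

section weight

variable (hp2 : p ≠ 2) {A B ε n₀ m L : ℕ} (hA : Even A) (hAB : 2 * B ≤ A) (hε : ε ≤ 1) (hn₀ : n₀ < p)
  {g : ℕ → ℚ} (hgI : ∀ k, k ≤ n₀ + (m + 1) * p → Rat.padicValuation p (g k) ≤ 1)
  (hgS : ∀ k, k ≤ n₀ + (m + 1) * p →
    Rat.padicValuation p (g (n₀ + (m + 1) * p - k) + (-1) ^ ε * g k) ≤ exp (-((L : ℤ) + 1)))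
  (hgD : ∀ e k k', 1 ≤ e → e ≤ L + 1 → k ≤ n₀ + (m + 1) * p → k' ≤ n₀ + (m + 1) * p → (p : ℤ) ^ e ∣ (k : ℤ) - k' →
    Rat.padicValuation p (g k' - g k) ≤ exp (-(e : ℤ)))
include hp2 hA hAB hn₀

/-- `p^A ∣ μ_k` for every hole cell (`n₀ < k₀ < p`, `K' ≤ m`). -/
theorem mu_le {k₀ K' : ℕ} (hk₀ : n₀ < k₀) (hk₀p : k₀ < p) (hK' : K' ≤ m) :
    Rat.padicValuation p (cTop A B ε (n₀ + (m + 1) * p) (k₀ + K' * p) / cTop A B 0 m K') ≤ exp (-(A : ℤ)) := by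
  obtain ⟨M, rfl⟩ := Nat.exists_eq_add_of_le hK'
  exact padicValuation_mu_le hp2 hA hAB (i := k₀) (i' := n₀ + p - k₀) (by omega) hk₀p (by omega) hn₀
    (div_mul_cancel₀ _ (cTop_zero_ne_zero (Nat.le_add_right K' M) A B))

include hgI in
/-- **`p^A ∣ G(K')`**: `v(G(K')) ≤ exp(−A)` (`K' ≤ m`). -/
theorem holeWeight_le {K' : ℕ} (hK' : K' ≤ m) :
    Rat.padicValuation p (holeWeight A B ε p n₀ m g K') ≤ exp (-(A : ℤ)) := by
  unfold holeWeight
  refine Valuation.map_sum_le _ fun k₀ hk₀ => ?_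
  have hk₀' := mem_Ico.1 hk₀
  have hkn : k₀ + K' * p ≤ n₀ + (m + 1) * p := by nlinarith
  rw [map_mul]
  calc _ ≤ 1 * exp (-(A : ℤ)) := mul_le_mul' (hgI _ hkn) (mu_le hp2 hA hAB hn₀ (by omega) hk₀'.2 hK')
    _ = _ := one_mul _

include hε hgS in
/-- **(S) for the hole weight**: `v(G(m−K') + G(K')) ≤ exp(−(A+L+1))` — reflect `k ↦ n − k` (hole digit
`k₀ ↦ n₀ + p − k₀`, block `K' ↦ m − K'`; `μ_{n−k} = (−1)^ε μ_k` by `cTop_reflect`) and use (S_ε) for `g` at level `L+1`. -/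
theorem holeWeight_reflect_add_le {K' : ℕ} (hK' : K' ≤ m) :
    Rat.padicValuation p (holeWeight A B ε p n₀ m g (m - K') + holeWeight A B ε p n₀ m g K') ≤
      exp (-((A : ℤ) + L + 1)) := by
  have hp : p.Prime := Fact.out
  set n := n₀ + (m + 1) * p with hn
  unfold holeWeight
  rw [Finset.sum_Ico_eq_sum_range, Finset.sum_Ico_eq_sum_range,
    ← Finset.sum_range_reflect (fun t => g (n₀ + 1 + t + (m - K') * p) * _) (p - (n₀ + 1)), ← Finset.sum_add_distrib]
  refine Valuation.map_sum_le _ fun t ht => ?_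
  have ht' := mem_range.1 ht
  have hKp : K' * p ≤ m * p := Nat.mul_le_mul_right _ hK'
  have e2 : (m + 1) * p = m * p + p := by ring
  have hkn : n₀ + 1 + t + K' * p ≤ n := by rw [hn]; omega
  have hrefl : n₀ + 1 + (p - (n₀ + 1) - 1 - t) + (m - K') * p = n - (n₀ + 1 + t + K' * p) := by
    rw [hn, Nat.sub_mul, add_mul, one_mul]; omega
  rw [hrefl, cTop_reflect_le_one hA B hε hkn, show m - K' = m - K' from rfl, cTop_zero_reflect hA B hK',
    show g (n - (n₀ + 1 + t + K' * p)) * ((-1) ^ ε * cTop A B ε n (n₀ + 1 + t + K' * p) / cTop A B 0 m K') +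
        g (n₀ + 1 + t + K' * p) * (cTop A B ε n (n₀ + 1 + t + K' * p) / cTop A B 0 m K') =
      ((-1) ^ ε * (cTop A B ε n (n₀ + 1 + t + K' * p) / cTop A B 0 m K')) *
        (g (n - (n₀ + 1 + t + K' * p)) + (-1) ^ ε * g (n₀ + 1 + t + K' * p)) by
      rcases Nat.le_one_iff_eq_zero_or_eq_one.1 hε with h | h <;> subst h <;> ring, map_mul, map_mul, map_pow,
    Valuation.map_neg, map_one, one_pow, one_mul]
  calc _ ≤ exp (-(A : ℤ)) * exp (-((L : ℤ) + 1)) :=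
        mul_le_mul' (mu_le hp2 hA hAB hn₀ (by omega) (by omega) hK') (hgS _ hkn)
    _ = _ := by rw [← exp_add]; congr 1; ring

include hgI hgD in
/-- **(D) for the hole weight**: `v(G(K'₂) − G(K'₁)) ≤ exp(−(A+e))` for blocks `K'₁, K'₂ ≤ m` with `p^e ∣ K'₁ − K'₂`,
`1 ≤ e ≤ L` ((D)_{e+1} for `g`, LEMMA 10.2 (c) for `μ`). -/
theorem holeWeight_local {e K₁ K₂ : ℕ} (he : 1 ≤ e) (heL : e ≤ L) (hK₁ : K₁ ≤ m) (hK₂ : K₂ ≤ m)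
    (hdvd : (p : ℤ) ^ e ∣ (K₁ : ℤ) - K₂) :
    Rat.padicValuation p (holeWeight A B ε p n₀ m g K₂ - holeWeight A B ε p n₀ m g K₁) ≤ exp (-((A : ℤ) + e)) := by
  have hp : p.Prime := Fact.out
  wlog hle : K₁ ≤ K₂ generalizing K₁ K₂
  · rw [Valuation.map_sub_swap]
    exact this hK₂ hK₁ (by rw [← neg_sub]; exact (dvd_neg).2 hdvd) (by omega)
  obtain ⟨d, rfl⟩ := Nat.exists_eq_add_of_le hle
  obtain ⟨q, hq⟩ : p ^ e ∣ d := by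
    have : (p : ℤ) ^ e ∣ (d : ℤ) := by
      have h := (dvd_neg).2 hdvd
      rw [neg_sub] at h; push_cast at h; rwa [add_sub_cancel_left] at h
    exact_mod_cast this
  obtain ⟨M₂, hM₂⟩ := Nat.exists_eq_add_of_le hK₂
  obtain ⟨M₁, hM₁⟩ := Nat.exists_eq_add_of_le hK₁
  unfold holeWeight
  rw [← Finset.sum_sub_distrib]
  refine Valuation.map_sum_le _ fun k₀ hk₀ => ?_
  have hk₀' := mem_Ico.1 hk₀
  have hkn : k₀ + K₁ * p ≤ n₀ + (m + 1) * p := by nlinarith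
  have hkn' : k₀ + (K₁ + d) * p ≤ n₀ + (m + 1) * p := by nlinarith
  rw [show g (k₀ + (K₁ + d) * p) * (cTop A B ε (n₀ + (m + 1) * p) (k₀ + (K₁ + d) * p) / cTop A B 0 m (K₁ + d)) -
      g (k₀ + K₁ * p) * (cTop A B ε (n₀ + (m + 1) * p) (k₀ + K₁ * p) / cTop A B 0 m K₁) =
    g (k₀ + (K₁ + d) * p) * (cTop A B ε (n₀ + (m + 1) * p) (k₀ + (K₁ + d) * p) / cTop A B 0 m (K₁ + d) -
      cTop A B ε (n₀ + (m + 1) * p) (k₀ + K₁ * p) / cTop A B 0 m K₁) +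
    (g (k₀ + (K₁ + d) * p) - g (k₀ + K₁ * p)) * (cTop A B ε (n₀ + (m + 1) * p) (k₀ + K₁ * p) / cTop A B 0 m K₁) by ring]
  refine Valuation.map_add_le _ ?_ ?_
  · rw [map_mul]
    have hμ := mu_local hp2 (A := A) (B := B) (ε := ε) (n₀ := n₀) (i := k₀) (i' := n₀ + p - k₀) (J := K₁) (M := M₁)
      (J' := K₁ + d) (M' := M₂) (e := e) (q := q) (by omega) (by rw [hq]; ring) hA hAB (by omega) hk₀'.2 (by omega) hn₀
      (by rw [← hM₁]; exact div_mul_cancel₀ _ (cTop_zero_ne_zero hK₁ A B))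
      (by rw [← hM₂]; exact div_mul_cancel₀ _ (cTop_zero_ne_zero hK₂ A B))
    calc _ ≤ 1 * exp (-((A : ℤ) + e)) := mul_le_mul' (hgI _ hkn') hμ
      _ = _ := one_mul _
  · rw [map_mul]
    have hg := hgD (e + 1) (k₀ + K₁ * p) (k₀ + (K₁ + d) * p) (by omega) (by omega) hkn hkn' (by
      rw [hq]; push_cast; exact ⟨-(q : ℤ), by ring⟩)
    calc _ ≤ exp (-(((e + 1 : ℕ)) : ℤ)) * exp (-(A : ℤ)) := mul_le_mul' hg (mu_le hp2 hA hAB hn₀ (by omega) hk₀'.2 hK₁)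
      _ ≤ _ := by rw [← exp_add, exp_le_exp]; push_cast; omega

end weight

end

end Summit.KontsevichZagierPeriods.Zeta5Search.BrickHoleWeight
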